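import Mathlib
import Summits.ValiantsHypothesis.ValiantsHypothesis.Theorems.LiouvilleSarnakAlignedTypeICharactersMod2nParseval
import HarnessLib

/-!
# Route LiouvilleSarnak — support `AlignedTypeI` (stmt-ValiantsHypothesis-21040), line `characters_mod_2n`:
# the registered stub `stub_kmtVariance` in the Green range of levels, unconditionally

The registered stub `stub_kmtVariance : KMTVariance` (Klurman–Mangerel–Teräväinen 2023, Thm 1.3 for `λ` and
`2`-power moduli) asks, for every `ε > 0` and all levels `k₀(ε) ≤ k ≤ n` (`n ≥ n₀(ε)`), for a character `χ₁`
mod `2^k` with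
`Σ_{u ∈ (ℤ/2^k)ˣ} |Σ_{b<2^n} λ(u + 2^k b) − (χ₁(u)/φ(2^k)) Σ_{m ≤ 2^(n+k)} λ(m) χ̄₁(m)|² ≤ ε 2^k 4^n`.
By the Parseval identity of `…CharactersMod2nParseval.lean` (`variance_eq_charMeanSquare`) the left side is
`φ(2^k)⁻¹ Σ_{ψ ≠ χ₁} |Σ_{m ≤ x} λ(m) ψ(m)|²`, `x = 2^(n+k)`.  In the GREEN RANGE of levels,
`2^k ≤ exp(c √(log x))` (Montgomery–Vaughan §11.3.1 Exercise 6 / Green 2012 Thm 3 for `2`-power moduli, PROVED in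
the tree: `LiouvilleTwoPower.norm_sum_liouville_character_le`, `|Σ_{m ≤ x} λ(m)ψ(m)| ≤ C x e^{-c√log x}` for EVERY
`ψ` mod `2^k`), each of the `φ(2^k)` summands is at most `C² x² e^{-2c√log x}`, whence the variance is at most
`C² 4^(n+k) e^{-2c√log x} ≤ (C² e^{-c√log x}) · 2^k 4^n ≤ ε 2^k 4^n` for `n ≥ n₀(ε)` — for EVERY `χ₁`.

Results (all unconditional, standard axioms):
* `variance_le_of_two_pow_le_exp` — the stub's inequality for all levels `k ≥ 1` with `2^k ≤ e^{c√log 2^(n+k)}`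
  and every `χ₁`;
* `variance_le_of_le_sqrt` — hence for all levels `1 ≤ k ≤ c'√n`;
* `variance_le_of_level_le` — hence for all levels `1 ≤ k ≤ K`, `K` fixed;
* `kmtVariance_of_le_sqrt` — the stub's `∃ χ` form on the initial segment of levels `k₀ ≤ k ≤ min(n, c'√n)`.

HONEST FRAMING.  This closes the registered statement `KMTVariance` only on the initial segment of levels
`k ≤ c'√n` (modulus `2^k ≤ e^{c√log x}`, the range of the classical zero-free region); the levels the crux
`AlignedTypeI` actually needs are the TOP ones, `n − O(log ε⁻¹) ≤ k ≤ n` (modulus `2^k ≍ √x`), where the only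
known input is KMT 2023 Thm 1.3 (§10: Chang-type short character sums to smooth moduli, a bounded large-values
count for prime-supported character sums, a sifted Halász bound, and the Matomäki–Radziwiłł architecture in the
`q`-aspect).  `stub_kmtVariance` is NOT closed; `AlignedTypeI` is NOT closed; nothing here bears on `VP ≠ VNP`.
-/

set_option linter.dupNamespace false

noncomputable section

namespace Summit.ValiantsHypothesis.ValiantsHypothesis.Theorems.LiouvilleSarnak.AlignedTypeI.CharactersModTwoN

open ArithmeticFunction Finset
open scoped BigOperators

/-! ## §1 Counting characters mod `2^k` -/

/-- There are `φ(2^k)` Dirichlet characters mod `2^k` with values in `ℂ`. [folklore] -/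
theorem card_dirichletCharacter_two_pow (k : ℕ) :
    (Finset.univ : Finset (DirichletCharacter ℂ (2 ^ k))).card = Nat.totient (2 ^ k) := by
  haveI : NeZero (2 ^ k) := ⟨pow_ne_zero _ two_ne_zero⟩
  rw [Finset.card_univ, ← Nat.card_eq_fintype_card]
  exact DirichletCharacter.card_eq_totient_of_hasEnoughRootsOfUnity ℂ (2 ^ k)

/-! ## §2 The variance in the Green range -/

/-- **The stub's inequality in the Green range, for every `χ₁`.**  There is an absolute `c > 0` such that for
every `ε > 0` and all `n ≥ n₀(ε)`: for every level `k ≥ 1` with `2^k ≤ exp(c √(log 2^(n+k)))` and EVERY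
Dirichlet character `χ₁` mod `2^k`,
`Σ_{u ∈ (ℤ/2^k)ˣ} ‖Σ_{b<2^n} λ(u + 2^k b) − (χ₁(u)/φ(2^k)) Σ_{m ≤ 2^(n+k)} λ(m) χ̄₁(m)‖² ≤ ε 2^k 4^n`.
Parseval (`variance_eq_charMeanSquare`) plus the tree's proved `LiouvilleTwoPower.norm_sum_liouville_character_le`.
[cite: MontgomeryVaughan2007, §11.3.1 Exercise 6; Green2012, Theorem 3] -/
theorem variance_le_of_two_pow_le_exp :
    ∃ c : ℝ, 0 < c ∧ ∀ ε : ℝ, 0 < ε → ∃ n₀ : ℕ, ∀ n ≥ n₀, ∀ k : ℕ, 1 ≤ k →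
      (2 : ℝ) ^ k ≤ Real.exp (c * Real.sqrt (Real.log ((2 : ℝ) ^ (n + k)))) →
      ∀ χ₁ : DirichletCharacter ℂ (2 ^ k),
        ∑ u : (ZMod (2 ^ k))ˣ,
          ‖(∑ b : Fin (2 ^ n), ((liouville ((u : ZMod (2 ^ k)).val + 2 ^ k * (b : ℕ)) : ℤ) : ℂ))
            - χ₁ (u : ZMod (2 ^ k)) / (Nat.totient (2 ^ k) : ℂ) *
              ∑ m : Fin (2 ^ (n + k)), ((liouville ((m : ℕ) + 1) : ℤ) : ℂ) *
                star (χ₁ (((m : ℕ) + 1 : ℕ) : ZMod (2 ^ k)))‖ ^ 2 ≤ ε * 2 ^ k * 4 ^ n := by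
  obtain ⟨c, hc, C, hC0, h⟩ :=
    Literature.NumberTheory.LFunctions.LiouvilleTwoPower.norm_sum_liouville_character_le
  refine ⟨c, hc, fun ε hε => ?_⟩
  -- it suffices that `√(log x) ≥ L := log ((C² + 1) / ε) / c`, i.e. `n log 2 ≥ (max L 0)²`
  set L : ℝ := Real.log ((C ^ 2 + 1) / ε) / c with hL
  have hlog2 : 0 < Real.log 2 := Real.log_pos one_lt_two
  obtain ⟨N, hN⟩ := exists_nat_ge (max L 0 ^ 2 / Real.log 2)
  refine ⟨max N 1, fun n hn k hk1 hk χ₁ => ?_⟩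
  haveI : NeZero (2 ^ k) := ⟨pow_ne_zero _ two_ne_zero⟩
  have hnN : (N : ℝ) ≤ n := by exact_mod_cast le_trans (le_max_left _ _) hn
  set x : ℝ := (2 : ℝ) ^ (n + k) with hx
  have hx2 : (2 : ℝ) ≤ x := by
    calc (2 : ℝ) = 2 ^ 1 := by norm_num
      _ ≤ 2 ^ (n + k) := pow_le_pow_right₀ (by norm_num) (by omega)
  have hlogx_ge : (n : ℝ) * Real.log 2 ≤ Real.log x := mul_log_two_le_log_two_pow n k
  set E : ℝ := Real.exp (-c * Real.sqrt (Real.log x)) with hE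
  have hE0 : 0 < E := Real.exp_pos _
  -- every character sum is `≤ C x E`
  have hS : ∀ ψ : DirichletCharacter ℂ (2 ^ k),
      ‖∑ m : Fin (2 ^ (n + k)), ((liouville ((m : ℕ) + 1) : ℤ) : ℂ) * ψ (((m : ℕ) + 1 : ℕ) : ZMod (2 ^ k))‖
        ≤ C * x * E := by
    intro ψ
    rw [twistedSum_eq_Ioc_floor]
    exact h k ψ x hx2 hk
  -- `2^k E ≤ 1`
  have h1 : (2 : ℝ) ^ k * E ≤ 1 := by
    rw [hE, neg_mul, Real.exp_neg]
    exact mul_inv_le_one_of_le₀ hk (Real.exp_pos _).le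
  -- `C² E ≤ ε`
  have h2 : C ^ 2 * E ≤ ε := by
    have hs : L ≤ Real.sqrt (Real.log x) := by
      have h3 : (max L 0) ^ 2 ≤ Real.log x := by
        have h4 : (max L 0) ^ 2 / Real.log 2 ≤ n := le_trans hN hnN
        rw [div_le_iff₀ hlog2] at h4
        exact h4.trans hlogx_ge
      have h5 : max L 0 ≤ Real.sqrt (Real.log x) := by
        rw [← Real.sqrt_sq (le_max_right L 0)]
        exact Real.sqrt_le_sqrt h3
      exact (le_max_left _ _).trans h5
    have hexp : E ≤ ε / (C ^ 2 + 1) := by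
      have h4 : Real.log ((C ^ 2 + 1) / ε) ≤ c * Real.sqrt (Real.log x) := by
        have h5 : c * L ≤ c * Real.sqrt (Real.log x) := mul_le_mul_of_nonneg_left hs hc.le
        have h6 : c * L = Real.log ((C ^ 2 + 1) / ε) := by rw [hL]; field_simp
        linarith
      calc E = Real.exp (-c * Real.sqrt (Real.log x)) := hE
        _ ≤ Real.exp (-Real.log ((C ^ 2 + 1) / ε)) := Real.exp_le_exp.mpr (by linarith)
        _ = ε / (C ^ 2 + 1) := by rw [Real.exp_neg, Real.exp_log (by positivity), inv_div]
    calc C ^ 2 * E ≤ C ^ 2 * (ε / (C ^ 2 + 1)) := by gcongr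
      _ = C ^ 2 / (C ^ 2 + 1) * ε := by ring
      _ ≤ 1 * ε := by
          gcongr
          exact (div_le_one (by positivity)).mpr (by linarith)
      _ = ε := one_mul _
  -- Parseval and the count of characters
  rw [variance_eq_charMeanSquare n k hk1 χ₁]
  have hφ0 : (0 : ℝ) < (Nat.totient (2 ^ k) : ℝ) := by
    exact_mod_cast Nat.totient_pos.mpr (pow_pos two_pos k)
  have hsum : ∑ ψ ∈ (Finset.univ : Finset (DirichletCharacter ℂ (2 ^ k))).erase χ₁,
      ‖∑ m : Fin (2 ^ (n + k)), ((liouville ((m : ℕ) + 1) : ℤ) : ℂ) * ψ (((m : ℕ) + 1 : ℕ) : ZMod (2 ^ k))‖ ^ 2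
        ≤ (Nat.totient (2 ^ k) : ℝ) * (C * x * E) ^ 2 := by
    calc ∑ ψ ∈ (Finset.univ : Finset (DirichletCharacter ℂ (2 ^ k))).erase χ₁,
          ‖∑ m : Fin (2 ^ (n + k)), ((liouville ((m : ℕ) + 1) : ℤ) : ℂ) * ψ (((m : ℕ) + 1 : ℕ) : ZMod (2 ^ k))‖ ^ 2
        ≤ ∑ ψ ∈ (Finset.univ : Finset (DirichletCharacter ℂ (2 ^ k))),
          ‖∑ m : Fin (2 ^ (n + k)), ((liouville ((m : ℕ) + 1) : ℤ) : ℂ) * ψ (((m : ℕ) + 1 : ℕ) : ZMod (2 ^ k))‖ ^ 2 :=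
          Finset.sum_le_sum_of_subset_of_nonneg (Finset.erase_subset _ _) (fun _ _ _ => by positivity)
      _ ≤ ∑ ψ ∈ (Finset.univ : Finset (DirichletCharacter ℂ (2 ^ k))), (C * x * E) ^ 2 :=
          Finset.sum_le_sum fun ψ _ => pow_le_pow_left₀ (norm_nonneg _) (hS ψ) 2
      _ = (Nat.totient (2 ^ k) : ℝ) * (C * x * E) ^ 2 := by
          rw [Finset.sum_const, nsmul_eq_mul, card_dirichletCharacter_two_pow]
  have h4 : (4 : ℝ) ^ n = 2 ^ n * 2 ^ n := by rw [← mul_pow]; norm_num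
  have hx' : x = 2 ^ n * 2 ^ k := by rw [hx, pow_add]
  calc (Nat.totient (2 ^ k) : ℝ)⁻¹ * ∑ ψ ∈ (Finset.univ : Finset (DirichletCharacter ℂ (2 ^ k))).erase χ₁,
        ‖∑ m : Fin (2 ^ (n + k)), ((liouville ((m : ℕ) + 1) : ℤ) : ℂ) * ψ (((m : ℕ) + 1 : ℕ) : ZMod (2 ^ k))‖ ^ 2
      ≤ (Nat.totient (2 ^ k) : ℝ)⁻¹ * ((Nat.totient (2 ^ k) : ℝ) * (C * x * E) ^ 2) :=
        mul_le_mul_of_nonneg_left hsum (inv_nonneg.mpr hφ0.le)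
    _ = (C * x * E) ^ 2 := by field_simp
    _ = (C ^ 2 * E) * (2 ^ k * E) * (2 ^ k * (2 ^ n * 2 ^ n)) := by rw [hx']; ring
    _ ≤ ε * 1 * (2 ^ k * (2 ^ n * 2 ^ n)) := by
        have h0 : (0 : ℝ) ≤ C ^ 2 * E := by positivity
        have h0' : (0 : ℝ) ≤ 2 ^ k * E := by positivity
        gcongr
    _ = ε * 2 ^ k * 4 ^ n := by rw [h4]; ring

/-- **All levels `1 ≤ k ≤ c' √n`, every `χ₁`.**  There is an absolute `c' > 0` such that for every `ε > 0`
and all `n ≥ n₀(ε)`, every level `1 ≤ k ≤ c' √n` and every character `χ₁` mod `2^k` satisfy the stub's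
inequality (`2^k = e^{k log 2} ≤ e^{c √(n log 2)} ≤ e^{c √log 2^(n+k)}` for `c' = c / √log 2`). [folklore] -/
theorem variance_le_of_le_sqrt :
    ∃ c' : ℝ, 0 < c' ∧ ∀ ε : ℝ, 0 < ε → ∃ n₀ : ℕ, ∀ n ≥ n₀, ∀ k : ℕ, 1 ≤ k → (k : ℝ) ≤ c' * Real.sqrt n →
      ∀ χ₁ : DirichletCharacter ℂ (2 ^ k),
        ∑ u : (ZMod (2 ^ k))ˣ,
          ‖(∑ b : Fin (2 ^ n), ((liouville ((u : ZMod (2 ^ k)).val + 2 ^ k * (b : ℕ)) : ℤ) : ℂ))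
            - χ₁ (u : ZMod (2 ^ k)) / (Nat.totient (2 ^ k) : ℂ) *
              ∑ m : Fin (2 ^ (n + k)), ((liouville ((m : ℕ) + 1) : ℤ) : ℂ) *
                star (χ₁ (((m : ℕ) + 1 : ℕ) : ZMod (2 ^ k)))‖ ^ 2 ≤ ε * 2 ^ k * 4 ^ n := by
  obtain ⟨c, hc, hmain⟩ := variance_le_of_two_pow_le_exp
  have hlog2 : 0 < Real.log 2 := Real.log_pos one_lt_two
  have hsl : 0 < Real.sqrt (Real.log 2) := Real.sqrt_pos.mpr hlog2
  refine ⟨c / Real.sqrt (Real.log 2), by positivity, fun ε hε => ?_⟩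
  obtain ⟨n₀, hn₀⟩ := hmain ε hε
  refine ⟨n₀, fun n hn k hk1 hk χ₁ => hn₀ n hn k hk1 ?_ χ₁⟩
  -- `2^k = e^{k log 2}` and `k log 2 ≤ c √(n log 2) ≤ c √(log 2^(n+k))`
  have h2k : (2 : ℝ) ^ k = Real.exp (k * Real.log 2) := by
    rw [← Real.rpow_natCast, Real.rpow_def_of_pos (by norm_num : (0 : ℝ) < 2), mul_comm]
  rw [h2k, Real.exp_le_exp]
  have h1 : (k : ℝ) * Real.log 2 ≤ c * (Real.sqrt n * Real.sqrt (Real.log 2)) := by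
    have h2 : (k : ℝ) * Real.log 2 ≤ c / Real.sqrt (Real.log 2) * Real.sqrt n * Real.log 2 :=
      mul_le_mul_of_nonneg_right hk hlog2.le
    have h3 : c / Real.sqrt (Real.log 2) * Real.sqrt n * Real.log 2
        = c * (Real.sqrt n * Real.sqrt (Real.log 2)) := by
      calc c / Real.sqrt (Real.log 2) * Real.sqrt n * Real.log 2
          = c * Real.sqrt n * (Real.log 2 / Real.sqrt (Real.log 2)) := by ring
        _ = c * Real.sqrt n * Real.sqrt (Real.log 2) := by rw [Real.div_sqrt]
        _ = c * (Real.sqrt n * Real.sqrt (Real.log 2)) := by ring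
    linarith
  refine h1.trans (mul_le_mul_of_nonneg_left ?_ hc.le)
  rw [← Real.sqrt_mul (Nat.cast_nonneg n)]
  exact Real.sqrt_le_sqrt (mul_log_two_le_log_two_pow n k)

/-- **All levels `1 ≤ k ≤ K`, `K` fixed, every `χ₁`.**  For every `K` and `ε > 0` there is `n₀` with: for all
`n ≥ n₀`, all `1 ≤ k ≤ K` and all `χ₁` mod `2^k` the stub's inequality holds. [folklore] -/
theorem variance_le_of_level_le (K : ℕ) :
    ∀ ε : ℝ, 0 < ε → ∃ n₀ : ℕ, ∀ n ≥ n₀, ∀ k : ℕ, 1 ≤ k → k ≤ K →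
      ∀ χ₁ : DirichletCharacter ℂ (2 ^ k),
        ∑ u : (ZMod (2 ^ k))ˣ,
          ‖(∑ b : Fin (2 ^ n), ((liouville ((u : ZMod (2 ^ k)).val + 2 ^ k * (b : ℕ)) : ℤ) : ℂ))
            - χ₁ (u : ZMod (2 ^ k)) / (Nat.totient (2 ^ k) : ℂ) *
              ∑ m : Fin (2 ^ (n + k)), ((liouville ((m : ℕ) + 1) : ℤ) : ℂ) *
                star (χ₁ (((m : ℕ) + 1 : ℕ) : ZMod (2 ^ k)))‖ ^ 2 ≤ ε * 2 ^ k * 4 ^ n := by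
  intro ε hε
  obtain ⟨c', hc', hmain⟩ := variance_le_of_le_sqrt
  obtain ⟨n₁, hn₁⟩ := hmain ε hε
  -- `K ≤ c' √n` as soon as `n ≥ (K / c')²`
  obtain ⟨N, hN⟩ := exists_nat_ge ((K / c') ^ 2)
  refine ⟨max n₁ N, fun n hn k hk1 hk χ₁ => hn₁ n (le_trans (le_max_left _ _) hn) k hk1 ?_ χ₁⟩
  have hnN : (K / c') ^ 2 ≤ (n : ℝ) := le_trans hN (by exact_mod_cast le_trans (le_max_right _ _) hn)
  have h1 : (K : ℝ) / c' ≤ Real.sqrt n := by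
    rw [← Real.sqrt_sq (by positivity : (0 : ℝ) ≤ K / c')]
    exact Real.sqrt_le_sqrt hnN
  calc (k : ℝ) ≤ K := by exact_mod_cast hk
    _ = c' * (K / c') := by field_simp
    _ ≤ c' * Real.sqrt n := mul_le_mul_of_nonneg_left h1 hc'.le

/-! ## §3 The stub on the initial segment of levels -/

/-- **`KMTVariance` on the initial segment of levels, unconditionally.**  There is an absolute `c' > 0` such
that for every `ε > 0` there are `k₀, n₀` with: for all `n ≥ n₀` and all levels `k₀ ≤ k ≤ n` that ALSO satisfy
`k ≤ c'√n`, some (indeed every; witness `χ = 1`) character `χ` mod `2^k` satisfies the stub's inequality — the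
registered `KMTVariance` with its level range `[k₀, n]` cut down to `[k₀, min(n, c'√n)]`.  The complementary
range `c'√n < k ≤ n` (modulus beyond `e^{c√log x}`) is the open content of KMT 2023 Thm 1.3. [folklore] -/
theorem kmtVariance_of_le_sqrt :
    ∃ c' : ℝ, 0 < c' ∧ ∀ ε : ℝ, 0 < ε → ∃ k₀ n₀ : ℕ, ∀ n ≥ n₀, ∀ k : ℕ, k₀ ≤ k → k ≤ n →
      (k : ℝ) ≤ c' * Real.sqrt n →
      ∃ χ : DirichletCharacter ℂ (2 ^ k),
        ∑ u : (ZMod (2 ^ k))ˣ,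
          ‖(∑ b : Fin (2 ^ n), ((liouville ((u : ZMod (2 ^ k)).val + 2 ^ k * (b : ℕ)) : ℤ) : ℂ))
            - χ (u : ZMod (2 ^ k)) / (Nat.totient (2 ^ k) : ℂ) *
              ∑ m : Fin (2 ^ (n + k)), ((liouville ((m : ℕ) + 1) : ℤ) : ℂ) *
                star (χ (((m : ℕ) + 1 : ℕ) : ZMod (2 ^ k)))‖ ^ 2 ≤ ε * 2 ^ k * 4 ^ n := by
  obtain ⟨c', hc', hmain⟩ := variance_le_of_le_sqrt
  refine ⟨c', hc', fun ε hε => ?_⟩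
  obtain ⟨n₀, hn₀⟩ := hmain ε hε
  exact ⟨1, n₀, fun n hn k hk1 _ hk => ⟨1, hn₀ n hn k hk1 hk 1⟩⟩

end Summit.ValiantsHypothesis.ValiantsHypothesis.Theorems.LiouvilleSarnak.AlignedTypeI.CharactersModTwoN
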